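import Summits.Ventures.DiscreteObjects.PP12.FlagOrbitMatrix
import Summits.Ventures.DiscreteObjects.PP12.FlagOrbitIndexSets

/-!
# The generic flag-cell orbit matrix: the rows ARE the non-trivial line orbits (kernel; Step B of the generic FlagOrbitReduction, continued)
Framing: lottery ticket; floor = certified bounds/negative ranges.

Cell pub-namedobj (venture DiscreteObjects), target (M), designs gen 15; generic sibling of `FlagSevenRowOrbits` (`f = 7`). Setting as in
`FlagOrbitIndexSets` (order 12, flag type, `σ³ = 1`, `f = 13 − 3ρ`, class representatives `repF s`). For the row index type
`FRow ρ = Fin ρ ⊕ (Fin ρ × Fin 12) ⊕ (Fin (12 − 3ρ) × Fin 4)`: `rowOrbitR` (`Γ_s = orb3 (repF s)`, the side orbit `orb3 (sideOf x_{s,i})`, the T-line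
orbit `(k,t)` through `y_k`), representative lines `lineRepR` (`rowOrbitR_eq_orb3_lineRepR`), `rowOrbitR_mem_lineOrbits3`, `rowOrbitR_injective`,
`exists_rowOrbitR_eq` (a non-fixed line is a c-line of some class, a T-line through a fixed `y ≠ c`, or an exterior line = a side of a triangle of
some class): a BIJECTION onto the non-trivial line orbits, so `Σ_{r : FRow ρ}` is `Σ_{B ∈ lineOrbits3 σ}` (`sum_rowOrbitR`). Also `lineRepR_not_fixed`
and `lineRepR_fixed_facts` (the fixed points on the representative lines: `c` on a c-line, none on a side, `y_k` on a T-line, `c` on no T-line).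
No `sorry`, no new axioms.
-/

namespace Summit.Ventures.DiscreteObjects.PP12

open Configuration Finset
open scoped Classical

namespace Collineation

variable {P L : Type*} [Membership P L] [ProjectivePlane P L] [Fintype P] [Fintype L] (σ : Collineation P L)

section Flag

variable {l : L} {c : P}

section Data

variable (hl : σ.onLines l = l) (hc : σ.onPoints c = c) (hcl : c ∈ l)
  (hP : ∀ p : P, σ.onPoints p = p → p ∈ l) (hL : ∀ m : L, σ.onLines m = m → c ∈ m) (h12 : ProjectivePlane.order P L = 12)
  (hq : σ.onPoints ^ 3 = 1) {ρ : ℕ} (hf : fixedCard σ.onPoints = 13 - 3 * ρ)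

/-- **The line orbit of a row** of the generic flag-cell orbit matrix. -/
noncomputable def rowOrbitR : FRow ρ → Finset L
  | Sum.inl s => orb3 σ.onLines (σ.repF hc hL h12 hq hf s)
  | Sum.inr (Sum.inl (s, i)) => orb3 σ.onLines (σ.sideOf l (σ.eTriR hc hL h12 hq hf s i).1)
  | Sum.inr (Sum.inr (k, t)) => (σ.eLOrb hl hcl hP hL h12 hq (σ.eFixPR hc hf k) t).1

/-- **A representative line of each row orbit**: `repF s`, the side `sideOf x_{s,i}`, a chosen T-line of the orbit `(k,t)`. -/
noncomputable def lineRepR : FRow ρ → L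
  | Sum.inl s => σ.repF hc hL h12 hq hf s
  | Sum.inr (Sum.inl (s, i)) => σ.sideOf l (σ.eTriR hc hL h12 hq hf s i).1
  | Sum.inr (Sum.inr (k, t)) => (mem_image.1 (σ.eLOrb hl hcl hP hL h12 hq (σ.eFixPR hc hf k) t).2).choose

/-- The chosen T-line of the orbit `(k,t)` passes through `y_k`, is `≠ l`, and generates the orbit. -/
theorem lineRepR_tline_spec (k : Fin (12 - 3 * ρ)) (t : Fin 4) :
    (σ.eFixPR hc hf k).1 ∈ σ.lineRepR hl hc hcl hP hL h12 hq hf (Sum.inr (Sum.inr (k, t))) ∧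
      σ.lineRepR hl hc hcl hP hL h12 hq hf (Sum.inr (Sum.inr (k, t))) ≠ l ∧
      orb3 σ.onLines (σ.lineRepR hl hc hcl hP hL h12 hq hf (Sum.inr (Sum.inr (k, t)))) = (σ.eLOrb hl hcl hP hL h12 hq (σ.eFixPR hc hf k) t).1 := by
  have hspec := (mem_image.1 (σ.eLOrb hl hcl hP hL h12 hq (σ.eFixPR hc hf k) t).2).choose_spec
  rw [mem_filter] at hspec
  exact ⟨hspec.1.2.1, hspec.1.2.2, hspec.2⟩

/-- Every row orbit is the orbit of its representative line. -/
theorem rowOrbitR_eq_orb3_lineRepR (r : FRow ρ) :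
    σ.rowOrbitR hl hc hcl hP hL h12 hq hf r = orb3 σ.onLines (σ.lineRepR hl hc hcl hP hL h12 hq hf r) := by
  rcases r with s | ⟨s, i⟩ | ⟨k, t⟩
  · rfl
  · rfl
  · exact (σ.lineRepR_tline_spec hl hc hcl hP hL h12 hq hf k t).2.2.symm

include hl hP in
/-- The side representative: the side of `x_{s,i}` passes through `x_{s,i}` and `σ x_{s,i}`, is not fixed and carries no fixed point. -/
theorem lineRepR_side_spec (s : Fin ρ) (i : Fin 12) :
    (σ.eTriR hc hL h12 hq hf s i).1 ∈ σ.sideOf l (σ.eTriR hc hL h12 hq hf s i).1 ∧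
      σ.onPoints (σ.eTriR hc hL h12 hq hf s i).1 ∈ σ.sideOf l (σ.eTriR hc hL h12 hq hf s i).1 ∧
      σ.onLines (σ.sideOf l (σ.eTriR hc hL h12 hq hf s i).1) ≠ σ.sideOf l (σ.eTriR hc hL h12 hq hf s i).1 ∧
      ∀ q : P, σ.onPoints q = q → q ∉ σ.sideOf l (σ.eTriR hc hL h12 hq hf s i).1 := by
  set x := σ.eTriR hc hL h12 hq hf s i
  have hxX := σ.exterior_of_triIdxR hc hL h12 hq hf s x
  have hxf : σ.onPoints x.1 ≠ x.1 := σ.not_fixed_of_exterior_flag hl hP hxX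
  obtain ⟨hxa, hσxa⟩ := σ.sideOf_spec l hxf
  exact ⟨hxa, hσxa, σ.side_no_fixed_point hxf hxX hxa hσxa⟩

/-! ### Rows -/

/-- Every row orbit is a non-trivial line orbit. -/
theorem rowOrbitR_mem_lineOrbits3 (r : FRow ρ) : σ.rowOrbitR hl hc hcl hP hL h12 hq hf r ∈ σ.lineOrbits3 := by
  unfold lineOrbits3
  rcases r with s | ⟨s, i⟩ | ⟨k, t⟩
  · exact mem_image.2 ⟨_, mem_filter.2 ⟨mem_univ _, (σ.repF_spec hc hL h12 hq hf s).2⟩, rfl⟩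
  · exact mem_image.2 ⟨_, mem_filter.2 ⟨mem_univ _, (σ.lineRepR_side_spec hl hc hP hL h12 hq hf s i).2.2.1⟩, rfl⟩
  · set y := σ.eFixPR hc hf k with hy
    obtain ⟨b, hb, hbeq⟩ := mem_image.1 (σ.eLOrb hl hcl hP hL h12 hq y t).2
    rw [mem_filter] at hb
    exact mem_image.2 ⟨b, mem_filter.2 ⟨mem_univ _, σ.tline_not_fixed hcl hP hL y.2.1 y.2.2 hb.2.1 hb.2.2⟩, hbeq⟩

/-- The representative line of a row is not fixed. -/
theorem lineRepR_not_fixed (r : FRow ρ) :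
    σ.onLines (σ.lineRepR hl hc hcl hP hL h12 hq hf r) ≠ σ.lineRepR hl hc hcl hP hL h12 hq hf r := by
  have hmem := σ.rowOrbitR_mem_lineOrbits3 hl hc hcl hP hL h12 hq hf r
  rw [σ.rowOrbitR_eq_orb3_lineRepR hl hc hcl hP hL h12 hq hf r] at hmem
  unfold lineOrbits3 at hmem
  obtain ⟨m, hm, hmeq⟩ := mem_image.1 hmem
  rw [mem_filter] at hm
  have ham : σ.lineRepR hl hc hcl hP hL h12 hq hf r ∈ orb3 σ.onLines m := by rw [hmeq]; exact self_mem_orb3 _ _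
  rw [mem_orb3] at ham
  rcases ham with e | e | e <;> rw [e]
  · exact hm.2
  · exact fun h => hm.2 (σ.onLines.injective h)
  · exact fun h => hm.2 (σ.onLines.injective (σ.onLines.injective h))

/-- **Fixed points on the representative lines:** on a c-line only `c`; on a side none; on the T-line `(k,t)` only `y_k`, and not `c`. -/
theorem lineRepR_fixed_facts :
    (∀ s : Fin ρ, c ∈ σ.lineRepR hl hc hcl hP hL h12 hq hf (Sum.inl s) ∧
      ∀ q : P, σ.onPoints q = q → q ∈ σ.lineRepR hl hc hcl hP hL h12 hq hf (Sum.inl s) → q = c) ∧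
    (∀ (x : Fin ρ × Fin 12) (q : P), σ.onPoints q = q → q ∉ σ.lineRepR hl hc hcl hP hL h12 hq hf (Sum.inr (Sum.inl x))) ∧
    (∀ (k : Fin (12 - 3 * ρ)) (t : Fin 4), (σ.eFixPR hc hf k).1 ∈ σ.lineRepR hl hc hcl hP hL h12 hq hf (Sum.inr (Sum.inr (k, t))) ∧
      c ∉ σ.lineRepR hl hc hcl hP hL h12 hq hf (Sum.inr (Sum.inr (k, t))) ∧
      ∀ q : P, σ.onPoints q = q → q ∈ σ.lineRepR hl hc hcl hP hL h12 hq hf (Sum.inr (Sum.inr (k, t))) → q = (σ.eFixPR hc hf k).1) := by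
  refine ⟨fun s => ?_, fun x q hqf => (σ.lineRepR_side_spec hl hc hP hL h12 hq hf x.1 x.2).2.2.2 q hqf, fun k t => ?_⟩
  · have hcs := σ.repF_spec hc hL h12 hq hf s
    have hul : σ.repF hc hL h12 hq hf s ≠ l := fun e => hcs.2 (by rw [e, hl])
    exact ⟨hcs.1, fun q hqf hqu => (Nondegenerate.eq_or_eq hqu hcs.1 (hP q hqf) hcl).resolve_right hul⟩
  · obtain ⟨hyb, hbl, -⟩ := σ.lineRepR_tline_spec hl hc hcl hP hL h12 hq hf k t
    exact ⟨hyb, σ.c_not_mem_tline hcl hP (σ.eFixPR hc hf k).2.1 (σ.eFixPR hc hf k).2.2 hyb hbl,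
      fun q hqf hqb => σ.tline_fixed_point_eq hP (σ.eFixPR hc hf k).2.1 hyb hbl hqb hqf⟩

/-- **The row indexing is injective.** -/
theorem rowOrbitR_injective : Function.Injective (σ.rowOrbitR hl hc hcl hP hL h12 hq hf) := by
  have hqL : σ.onLines ^ 3 = 1 := σ.onLines_pow_eq_one hq
  intro r₁ r₂ h
  have hcσ : ∀ v : L, c ∈ v → c ∈ σ.onLines v := fun v hv => by have := σ.mem_map hv; rwa [hc] at this
  have gfacts : ∀ s : Fin ρ, ∀ g ∈ orb3 σ.onLines (σ.repF hc hL h12 hq hf s), c ∈ g := by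
    intro s g hg
    have hcs := (σ.repF_spec hc hL h12 hq hf s).1
    rw [mem_orb3] at hg
    rcases hg with rfl | rfl | rfl
    · exact hcs
    · exact hcσ _ hcs
    · exact hcσ _ (hcσ _ hcs)
  have sfacts : ∀ (s : Fin ρ) (i : Fin 12), ∀ g ∈ orb3 σ.onLines (σ.sideOf l (σ.eTriR hc hL h12 hq hf s i).1),
      ∀ p : P, σ.onPoints p = p → p ∉ g :=
    fun s i g hg => σ.orb3_side_noFixed (σ.lineRepR_side_spec hl hc hP hL h12 hq hf s i).2.2.2 hg
  have tfacts : ∀ (k : Fin (12 - 3 * ρ)) (t : Fin 4), ∀ g ∈ ((σ.eLOrb hl hcl hP hL h12 hq (σ.eFixPR hc hf k) t).1 : Finset L),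
      (σ.eFixPR hc hf k).1 ∈ g ∧ c ∉ g := by
    intro k t g hg
    set y := σ.eFixPR hc hf k
    obtain ⟨b, hb, hbeq⟩ := mem_image.1 (σ.eLOrb hl hcl hP hL h12 hq y t).2
    rw [mem_filter] at hb
    rw [← hbeq, mem_orb3] at hg
    have hyσ : ∀ e : L, y.1 ∈ e → y.1 ∈ σ.onLines e := fun e he => by have := σ.mem_map he; rwa [y.2.1] at this
    have hlσ : ∀ e : L, e ≠ l → σ.onLines e ≠ l := fun e he h' => he (σ.onLines.injective (h'.trans hl.symm))
    have key : ∀ e : L, y.1 ∈ e → e ≠ l → y.1 ∈ e ∧ c ∉ e := fun e h1 h2 => ⟨h1, σ.c_not_mem_tline hcl hP y.2.1 y.2.2 h1 h2⟩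
    rcases hg with e | e | e <;> rw [e]
    · exact key b hb.2.1 hb.2.2
    · exact key _ (hyσ _ hb.2.1) (hlσ _ hb.2.2)
    · exact key _ (hyσ _ (hyσ _ hb.2.1)) (hlσ _ (hlσ _ hb.2.2))
  have tne : ∀ (k : Fin (12 - 3 * ρ)) (t : Fin 4), (((σ.eLOrb hl hcl hP hL h12 hq (σ.eFixPR hc hf k) t).1 : Finset L)).Nonempty :=
    fun k t => by
    obtain ⟨b, -, hbeq⟩ := mem_image.1 (σ.eLOrb hl hcl hP hL h12 hq (σ.eFixPR hc hf k) t).2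
    exact ⟨b, by rw [← hbeq]; exact self_mem_orb3 _ _⟩
  rcases r₁ with s | ⟨s, i⟩ | ⟨k, t⟩ <;> rcases r₂ with s' | ⟨s', i'⟩ | ⟨k', t'⟩ <;>
    simp only [rowOrbitR] at h
  · -- Γ / Γ
    by_contra hne
    have hss : s ≠ s' := fun e => hne (by rw [e])
    apply σ.repF_not_mem_orb3 hc hL h12 hq hf hss
    rw [h]; exact self_mem_orb3 _ _
  · exfalso
    exact sfacts s' i' _ (by rw [← h]; exact self_mem_orb3 _ _) c hc (gfacts s _ (self_mem_orb3 _ _))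
  · exfalso
    obtain ⟨g, hg⟩ := tne k' t'
    have hg' := hg; rw [← h] at hg'
    exact (tfacts k' t' g hg).2 (gfacts s g hg')
  · exfalso
    exact sfacts s i _ (by rw [h]; exact self_mem_orb3 _ _) c hc (gfacts s' _ (self_mem_orb3 _ _))
  · -- side / side
    set x := σ.eTriR hc hL h12 hq hf s i with hx
    set x' := σ.eTriR hc hL h12 hq hf s' i' with hx'
    have hxX := σ.exterior_of_triIdxR hc hL h12 hq hf s x
    have hx'X := σ.exterior_of_triIdxR hc hL h12 hq hf s' x'
    have hxf : σ.onPoints x.1 ≠ x.1 := σ.not_fixed_of_exterior_flag hl hP hxX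
    have hx'f : σ.onPoints x'.1 ≠ x'.1 := σ.not_fixed_of_exterior_flag hl hP hx'X
    obtain ⟨hx'a', hσx'a'⟩ := σ.sideOf_spec l hx'f
    have hmem : σ.sideOf l x'.1 ∈ orb3 σ.onLines (σ.sideOf l x.1) := by rw [h]; exact self_mem_orb3 _ _
    obtain ⟨R, hRx, hRg, hσRg⟩ := σ.side_of_mem_orb3_sideOf hq hxf hmem
    have hRX := σ.exterior_of_mem_orb3 hxX hRx
    have hx'R : x'.1 = R := σ.side_unique hRX hRg hσRg hx'a' hσx'a'
    have hx'x : x'.1 ∈ orb3 σ.onPoints x.1 := by rw [hx'R]; exact hRx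
    by_cases hss : s = s'
    · subst hss
      have heq : x'.1 = x.1 :=
        σ.vertex_eq_of_mem_orb3 hc hq (σ.repF_spec hc hL h12 hq hf s).1 (σ.repF_spec hc hL h12 hq hf s).2 x'.2.1 x.2.1 hx'x
      have : i' = i := (σ.eTriR hc hL h12 hq hf s).injective (Subtype.ext heq)
      rw [this]
    · exfalso
      have hxx' : x.1 ∈ orb3 σ.onPoints x'.1 := by rw [orb3_eq_of_mem σ.onPoints hq hx'x]; exact self_mem_orb3 _ _
      exact σ.triIdxR_class_unique hc hL h12 hq hf hss x' hxx' x.2.1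
  · exfalso
    obtain ⟨g, hg⟩ := tne k' t'
    have hg' := hg; rw [← h] at hg'
    exact sfacts s i g hg' _ (σ.eFixPR hc hf k').2.1 (tfacts k' t' g hg).1
  · exfalso
    obtain ⟨g, hg⟩ := tne k t
    have hg' := hg; rw [h] at hg'
    exact (tfacts k t g hg).2 (gfacts s' g hg')
  · exfalso
    obtain ⟨g, hg⟩ := tne k t
    have hg' := hg; rw [h] at hg'
    exact sfacts s' i' g hg' _ (σ.eFixPR hc hf k).2.1 (tfacts k t g hg).1
  · -- T / T
    obtain ⟨g, hg⟩ := tne k t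
    have hg' := hg; rw [h] at hg'
    obtain ⟨hyg, -⟩ := tfacts k t g hg
    obtain ⟨hy'g, hcg⟩ := tfacts k' t' g hg'
    have hkk : k = k' := by
      by_contra hne
      have hyy : (σ.eFixPR hc hf k).1 ≠ (σ.eFixPR hc hf k').1 := fun e => hne ((σ.eFixPR hc hf).injective (Subtype.ext e))
      have hgl : g = l :=
        (Nondegenerate.eq_or_eq hyg hy'g (hP _ (σ.eFixPR hc hf k).2.1) (hP _ (σ.eFixPR hc hf k').2.1)).resolve_left hyy
      exact hcg (hgl ▸ hcl)
    subst hkk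
    have : t = t' := (σ.eLOrb hl hcl hP hL h12 hq (σ.eFixPR hc hf k)).injective (Subtype.ext h)
    rw [this]

/-- **The row indexing is surjective** onto the non-trivial line orbits: a non-fixed line is a c-line (of some class), a T-line through a fixed
point `y ≠ c`, or an exterior line, i.e. a side of a triangle of some class. -/
theorem exists_rowOrbitR_eq {B : Finset L} (hB : B ∈ σ.lineOrbits3) : ∃ r : FRow ρ, σ.rowOrbitR hl hc hcl hP hL h12 hq hf r = B := by
  have hqL : σ.onLines ^ 3 = 1 := σ.onLines_pow_eq_one hq
  unfold lineOrbits3 at hB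
  obtain ⟨m, hm, rfl⟩ := mem_image.1 hB
  rw [mem_filter] at hm
  obtain ⟨-, hmf⟩ := hm
  by_cases hcm : c ∈ m
  · obtain ⟨s, hs⟩ := σ.exists_class_of_cline hc hL h12 hq hf hcm hmf
    refine ⟨Sum.inl s, ?_⟩
    simp only [rowOrbitR]
    exact (orb3_eq_of_mem σ.onLines hqL hs).symm
  · by_cases hfix : ∃ y : P, σ.onPoints y = y ∧ y ∈ m
    · obtain ⟨y, hy, hym⟩ := hfix
      have hyc : y ≠ c := fun e => hcm (e ▸ hym)
      have hml : m ≠ l := fun e => hcm (e ▸ hcl)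
      have hmem : orb3 σ.onLines m ∈ (univ.filter fun b : L => y ∈ b ∧ b ≠ l).image (orb3 σ.onLines) :=
        mem_image.2 ⟨m, mem_filter.2 ⟨mem_univ _, hym, hml⟩, rfl⟩
      set k := (σ.eFixPR hc hf).symm ⟨y, hy, hyc⟩ with hk
      have hyk : σ.eFixPR hc hf k = ⟨y, hy, hyc⟩ := by rw [hk, Equiv.apply_symm_apply]
      refine ⟨Sum.inr (Sum.inr (k, (σ.eLOrb hl hcl hP hL h12 hq (σ.eFixPR hc hf k)).symm ⟨_, by rw [hyk]; exact hmem⟩)), ?_⟩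
      simp only [rowOrbitR, Equiv.apply_symm_apply]
    · push Not at hfix
      have hm0 : ∀ p : P, σ.onPoints p = p → p ∉ m := fun p hp => hfix p hp
      obtain ⟨Q, hQ, hQm, hσQm⟩ := σ.exterior_line_is_side hl hc hcl hP hL hmf hm0
      obtain ⟨s, x, hxQ, hxu⟩ := σ.exists_class_of_exterior hl hc hcl hL h12 hq hf hQ.2
      have hxX := σ.exterior_of_mem_orb3 hQ.2 hxQ
      have hxc : x ≠ c := fun e => hxX l hl (e ▸ hcl)
      have hxf : σ.onPoints x ≠ x := σ.not_fixed_of_exterior_flag hl hP hxX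
      have hQx : Q ∈ orb3 σ.onPoints x := by rw [orb3_eq_of_mem σ.onPoints hq hxQ]; exact self_mem_orb3 _ _
      have hmo : m ∈ orb3 σ.onLines (σ.sideOf l x) := σ.mem_orb3_sideOf_of_side hq hxf hQx hQ.1 hQm hσQm
      refine ⟨Sum.inr (Sum.inl (s, (σ.eTriR hc hL h12 hq hf s).symm ⟨x, hxu, hxc⟩)), ?_⟩
      simp only [rowOrbitR, Equiv.apply_symm_apply]
      exact (orb3_eq_of_mem σ.onLines hqL hmo).symm

/-- `Σ_{r : FRow ρ} g (rowOrbitR r) = Σ_{B ∈ lineOrbits3 σ} g B`. -/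
theorem sum_rowOrbitR (g : Finset L → ℕ) : ∑ r : FRow ρ, g (σ.rowOrbitR hl hc hcl hP hL h12 hq hf r) = ∑ B ∈ σ.lineOrbits3, g B := by
  refine Finset.sum_bij (fun r _ => σ.rowOrbitR hl hc hcl hP hL h12 hq hf r) (fun r _ => σ.rowOrbitR_mem_lineOrbits3 hl hc hcl hP hL h12 hq hf r)
    (fun r₁ _ r₂ _ h => σ.rowOrbitR_injective hl hc hcl hP hL h12 hq hf h) (fun B hB => ?_) (fun r _ => rfl)
  obtain ⟨r, hr⟩ := σ.exists_rowOrbitR_eq hl hc hcl hP hL h12 hq hf hB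
  exact ⟨r, mem_univ _, hr⟩

end Data

end Flag

end Collineation

end Summit.Ventures.DiscreteObjects.PP12
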